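import Summits.BirchSwinnertonDyer.Rank1Residual.GaloisImage.SakamotoN11InstanceResidual
import Summits.BirchSwinnertonDyer.Rank1Residual.GaloisImage.KolyvaginLevelOneDualSelmerVanishing
import Summits.BirchSwinnertonDyer.Rank1Residual.Additive.X4ThreeSel3Certificate
import HarnessLib

/-!
# The EXOTIC unit case at level one: a level-one Kolyvagin certificate on `(E[3], 𝓕̄_can)` forces
# `Sel₃(E/ℚ) = 0`, hence `BSD(E,3)` on analytic-rank-`0` rows with `3 ∤ #Ш_an` — NO `3`-adic tower
# (cell `b2b-bsdres`, team n1011, row T-a5x; seat p13)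

HONEST FRAMING (cell `b2b-bsdres`, run/shared/lean/b2b/bsd-rank1-residual/, verbatim in every
file): the goal of the cell is to DELETE the COMBINATION-SHAPED residual classes of the
Birch–Swinnerton-Dyer formula for ALL analytic-rank `≤ 1` elliptic curves over `ℚ` — "full BSD
formula for every rank `≤ 1` curve in class `C`" assembled STRICTLY from published theorems — so
that the rank-`≤ 1` remainder becomes exactly the CONSTRUCTION-SHAPED classes, which are TYPED
(missing-input `Prop`s), NOT attempted. This is not "finishing BSD". Team n1011 (N10/N11, the
additive block `X4 ∧ p = 3`): research route; no claim beyond the stated classes; the label X4 and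
the mark of RESIDUAL-MAP §I N11 are UNCHANGED by this file; nothing is booked. Theorems only: no
definition, no named fact is minted. The end theorem is CONDITIONAL — on the tree's named facts
[S24] Thm. 4.4 (1)/(2) (`hS24`, `hS24₂`), Gross–Zagier–Kolyvagin (`hGZK`), Tate's local
Euler–Poincaré characteristic (`hEP`, which also discharges the located gap (Lp): n1011-p04 T-Lp), the
Poitou–Tate family, and a
LEVEL-ONE CERTIFICATE (a Kolyvagin system on `E[3]` whose bottom class is not a Selmer class —
NOT constructed here) — all explicit in the signature.

## What and why (row T-a5x: "EXOTIC unit case of X4♯(3) via level-1 Kolyvagin systems")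

On the EXOTIC rows of §I N11 (ClassX4 at `3`, `r_an = 0`, `ρ̄_{E,3}` onto, `ρ̄_{E,9}` NOT onto) the
`3`-adic tower and the image hypothesis (im) of the printed Kolyvagin-system theorems fail, but
Sakamoto's Thm. 4.4 at `m = 1` needs only surj(3) (p252385, p260356, `SakamotoN11InstanceResidual`).
This file draws the consequence for BSD at `3`:

* `atLevel_empty` — `𝓕(∅) = 𝓕` (`modify_empty`).
* `dualSelmerGroup_natCard_eq_one_propagatedSelmerStructureOne_of_apply_ne_zero` — a Kolyvagin system
  `κ ∈ KS₁(E[3], 𝓕̄_can, 𝒫(τ))` with `κ_d ≠ 0` kills the dual Selmer group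
  `H¹_{𝓕̄_can(d)^*}(ℚ, E[3]^∨(1))` (generic link `LevelOne.natCard_eq_one_of_apply_ne_zero` over
  Thm. 4.4 (1)–(2) at `m = 1` on `E[3]`).
* `natCard_selmerGroup_propagatedSelmerStructureOne_eq_three_of_apply_empty_ne_zero` — hence, with
  `inv' := inv` and `d = ∅`: `λ*(∅) = 0`, the evaluation `κ ↦ κ_∅` is a bijection
  `KS₁ ≅ H¹_{𝓕̄_can}(ℚ, E[3])` (Thm. 4.4 (1), second clause), so `#H¹_{𝓕̄_can}(ℚ, E[3]) = #KS₁ = 3`.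
* `natCard_selmerGroup_three_eq_one_of_levelOne_certificate` — if moreover `κ_∅` is NOT a `3`-Selmer
  class (its singular part at `3` is non-zero), then `Sel₃(E/ℚ) = H¹_𝓚 ≤ H¹_{𝓕̄_can}` (`𝓚 ≤ 𝓕̄_can`,
  n1011-p18) is a PROPER subgroup of a group of order `3`: **`#Sel^{(3)}(E/ℚ) = 1`**.
* **`bsdp_three_of_levelOne_certificate`** — with `r_an = 0` and `3 ∤ #Ш(E)_an`, p13's certificate
  consumer `Additive.X4RankZero.bsdp_three_of_card_selmerThree_eq_one` (p249557; Miller / Silverman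
  X.4.2) gives **`BSD(E, 3)`**.  `bsdp_three_exotic_of_levelOne_certificate` displays it on the
  EXOTIC rows (class binders documentation-only); `exists_kolyvaginDatum_bsdp_three_of_levelOne_certificate`
  discharges `τ`, `η`, `D` existentially (p260356 + p04's T-HCC), leaving the certificate `κ` universally
  quantified.

Binders of the end theorem (nothing hidden): `hS24`, `hS24₂`, `hGZK`; `[Finite E[3]]`; surj(3);
`r_an = 0`; `#Ш_an = q`, `ord₃ q = 0`; the `τ`-datum (exists: p260356); the Poitou–Tate family
`inv` ×4; `hEP` (Tate's local EPC — it now also discharges the located gap (Lp): n1011-p04 T-Lp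
`natCard_propagatedSelmerStructureOne_three`, p263840); an admissible `S ⊇ ∞ ∪ {3} ∪ {bad}`; a Kolyvagin datum on
`E[3]` for `𝒫(τ)` with the cyclotomic transverse conditions and the canonical comparison maps (`D`,
`η`, `hP`, `hT`, `hD`); and THE CERTIFICATE `κ`, `hκ : κ_∅ ∉ Sel₃` — in practice Kato's Kolyvagin
system at level one, whose bottom class has non-zero singular part at `3` iff (explicit reciprocity
law / DICT3 at the additive prime `3`, route R1-21/R1-24) the `L`-value is a `3`-adic unit; THAT
construction is the research content of the row and is NOT claimed here.  **EXOTIC rows are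
reduced to (F1)(F2)(F3)(PT)(EP)(Lp) + the certificate; none is closed** (referee-1 ACK-1 proviso,
skel/T-a5x-L1).  NO tower, NO (im), NO reduction-type hypothesis enters.  Nothing booked; no
mark / label changed.

References: R. Sakamoto, JTNB 36 (2024) Thm. 4.4 (p. 926) [Sakamoto2024]; B. Mazur, K. Rubin,
Mem. AMS 799 (2004) Cor. 4.5.2 [MazurRubin2004]; R. L. Miller, LMS J. Comput. Math. 14 (2011) §1
[Miller2011LMS]; J. H. Silverman, *AEC* X.4.2 [SilvermanAEC2009]; K. Kato, Astérisque 295 (2004)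
Thm. 12.5 (the intended certificate).
-/

noncomputable section

open scoped Classical NumberField ContRepresentation
open Field NumberField IsDedekindDomain
open WeierstrassCurve Literature.NumberTheory.EllipticCurves Literature.NumberTheory.GaloisRepresentations
  Literature.NumberTheory.GaloisRepresentations.DiscreteGaloisModule Literature.NumberTheory.GaloisCohomology

namespace Summit.BirchSwinnertonDyer.Rank1Residual.GaloisImage

variable (W : WeierstrassCurve ℚ) [W.IsElliptic]

/-- `𝓕(∅) = 𝓕`: the level-`1` vertex of the Selmer sheaf is the structure itself. [folklore] -/
theorem atLevel_empty {K : Type} [Field K] [NumberField K] {M : Type} [AddCommGroup M]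
    [TopologicalSpace M] [DiscreteTopology M] {ρ : DiscreteGaloisModule K M}
    (D : KolyvaginDatum ρ) (𝓕 : SelmerStructure ρ) : D.atLevel 𝓕 ∅ = 𝓕 :=
  SelmerStructure.modify_empty 𝓕 D.transverse

/-- **Level-one certificate ⟹ the dual Selmer group vanishes, on `(E[3], 𝓕̄_can)`.**  From surj(3)
alone (+ the two [S24] facts, the Poitou–Tate families, `hEP`, an admissible `S`, a Kolyvagin
datum on `E[3]`): if SOME `κ ∈ KS₁(E[3], 𝓕̄_can, 𝒫(τ))` has `κ_d ≠ 0` then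
`#H¹_{𝓕̄_can(d)^*}(ℚ, E[3]^∨(1)) = 1` (for the family `inv'`; generic link
`LevelOne.natCard_eq_one_of_apply_ne_zero` over Thm. 4.4 (1)–(2) at `m = 1`). [cite: Sakamoto2024, Thm. 4.4 (p. 926)] -/
theorem dualSelmerGroup_natCard_eq_one_propagatedSelmerStructureOne_of_apply_ne_zero
    (hS24 : Sakamoto2024.kolyvaginSystems_freeRankOne_zmod_three_pow)
    (hS24₂ : Sakamoto2024.kolyvaginSystems_idealOfBasis_eq_fittingIdeal_zmod_three_pow)
    [Finite (geomTorsion W ((3 : ℕ) : ℤ))]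
    (h3 : W.HasSurjectiveModNGaloisRep ((3 : ℕ) : ℤ))
    (τ : absoluteGaloisGroup ℚ) (hτμ : τ ∈ rootsOfUnityFixer ℚ 3)
    (hτq : Nonempty (cokerSubOne (W.torsionGaloisModule ((3 : ℕ) : ℤ)) τ ≃+ ZMod 3))
    (inv : LocalInvariants ℚ 3) (hperf : inv.IsPerfect) (hsum : inv.SumLocalTermEqZero)
    (hunro : inv.UnramifiedOrthogonal) (hcompl : inv.SelmerComplement)
    (hEP : ∀ v : HeightOneSpectrum (𝓞 ℚ), localEulerPoincareCharacteristic (v.adicCompletion ℚ))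
    (S : Finset (Place ℚ)) (hS : ∀ w : InfinitePlace ℚ, (Sum.inl w : Place ℚ) ∈ S)
    (h3S : ∀ v : HeightOneSpectrum (𝓞 ℚ), ((3 : ℕ) : 𝓞 ℚ) ∈ v.asIdeal → (Sum.inr v : Place ℚ) ∈ S)
    (hbadS : ∀ v : HeightOneSpectrum (𝓞 ℚ), ¬ W.HasGoodReductionAt v → (Sum.inr v : Place ℚ) ∈ S)
    (D : KolyvaginDatum (W.torsionGaloisModule ((3 : ℕ) : ℤ)))
    (η : (q : HeightOneSpectrum (𝓞 ℚ)) → (ZMod (Ideal.absNorm q.asIdeal))ˣ)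
    (hP : D.primes = frobeniusClassPrimes (W.torsionGaloisModule ((3 : ℕ) : ℤ))
      {v | (Sum.inr v : Place ℚ) ∈ S} τ 3)
    (hT : D.transverse = cyclotomicTransverse (W.torsionGaloisModule ((3 : ℕ) : ℤ)))
    (hD : D.HasCanonicalComparison 3 η)
    (inv' : LocalInvariants ℚ 3) (hperf' : inv'.IsPerfect) (hsum' : inv'.SumLocalTermEqZero)
    (hunro' : inv'.UnramifiedOrthogonal) (hcompl' : inv'.SelmerComplement)
    (d : Finset (HeightOneSpectrum (𝓞 ℚ))) (hd : D.IsLevel d)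
    (κ : D.kolyvaginSystems (propagatedSelmerStructureOne W 3)) (hκ : κ.1 d ≠ 0) :
    Nat.card (inv'.dualSelmerStructure (W.torsionGaloisModule ((3 : ℕ) : ℤ))
        (D.atLevel (propagatedSelmerStructureOne W 3) d)).selmerGroup = 1 := by
  have hfree := (kolyvaginSystems_freeRankOne_propagatedSelmerStructureOne_of_surj W hS24 h3 τ hτμ hτq
    inv hperf hsum hunro hcompl hEP S hS h3S hbadS D η hP hT hD).1
  have h2 := fun (g : D.kolyvaginSystems (propagatedSelmerStructureOne W 3))
      (hg : AddSubgroup.zmultiples g = ⊤) =>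
    (kolyvaginSystems_idealOfBasis_propagatedSelmerStructureOne_of_surj W hS24₂ h3 τ hτμ hτq inv hperf
      hsum hunro hcompl hEP S hS h3S hbadS D η hP hT hD inv' hperf' hsum' hunro' hcompl'
      g hg d hd).2
  have hexp : ∀ a : (inv'.dualSelmerStructure (W.torsionGaloisModule ((3 : ℕ) : ℤ))
      (D.atLevel (propagatedSelmerStructureOne W 3) d)).selmerGroup, 3 • a = 0 := fun a => by
    apply Subtype.ext
    rw [AddSubmonoidClass.coe_nsmul, ZeroMemClass.coe_zero]
    exact galoisCohomology.nsmul_eq_zero_of_forall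
      ((W.torsionGaloisModule ((3 : ℕ) : ℤ)).tateDual 3)
      (fun f => DiscreteGaloisModule.TateDual.nsmul_eq_zero f) a.1
  exact LevelOne.natCard_eq_one_of_apply_ne_zero Nat.prime_three hfree hexp h2 κ hκ

/-- **Level-one certificate ⟹ `#H¹_{𝓕̄_can}(ℚ, E[3]) = 3`.**  With the dual Selmer group of `𝓕̄_can`
trivial (previous theorem at `d = ∅` with `inv' := inv`), `λ*(∅) = 0`, so by the bijectivity clause
of Thm. 4.4 (1) the evaluation `κ ↦ κ_∅` is a bijection `KS₁(E[3], 𝓕̄_can, 𝒫(τ)) ≅ H¹_{𝓕̄_can}(ℚ, E[3])`,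
and `KS₁ ≅ 𝔽₃`.  [cite: Sakamoto2024, Thm. 4.4 (1) (p. 926)] -/
theorem natCard_selmerGroup_propagatedSelmerStructureOne_eq_three_of_apply_empty_ne_zero
    (hS24 : Sakamoto2024.kolyvaginSystems_freeRankOne_zmod_three_pow)
    (hS24₂ : Sakamoto2024.kolyvaginSystems_idealOfBasis_eq_fittingIdeal_zmod_three_pow)
    [Finite (geomTorsion W ((3 : ℕ) : ℤ))]
    (h3 : W.HasSurjectiveModNGaloisRep ((3 : ℕ) : ℤ))
    (τ : absoluteGaloisGroup ℚ) (hτμ : τ ∈ rootsOfUnityFixer ℚ 3)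
    (hτq : Nonempty (cokerSubOne (W.torsionGaloisModule ((3 : ℕ) : ℤ)) τ ≃+ ZMod 3))
    (inv : LocalInvariants ℚ 3) (hperf : inv.IsPerfect) (hsum : inv.SumLocalTermEqZero)
    (hunro : inv.UnramifiedOrthogonal) (hcompl : inv.SelmerComplement)
    (hEP : ∀ v : HeightOneSpectrum (𝓞 ℚ), localEulerPoincareCharacteristic (v.adicCompletion ℚ))
    (S : Finset (Place ℚ)) (hS : ∀ w : InfinitePlace ℚ, (Sum.inl w : Place ℚ) ∈ S)
    (h3S : ∀ v : HeightOneSpectrum (𝓞 ℚ), ((3 : ℕ) : 𝓞 ℚ) ∈ v.asIdeal → (Sum.inr v : Place ℚ) ∈ S)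
    (hbadS : ∀ v : HeightOneSpectrum (𝓞 ℚ), ¬ W.HasGoodReductionAt v → (Sum.inr v : Place ℚ) ∈ S)
    (D : KolyvaginDatum (W.torsionGaloisModule ((3 : ℕ) : ℤ)))
    (η : (q : HeightOneSpectrum (𝓞 ℚ)) → (ZMod (Ideal.absNorm q.asIdeal))ˣ)
    (hP : D.primes = frobeniusClassPrimes (W.torsionGaloisModule ((3 : ℕ) : ℤ))
      {v | (Sum.inr v : Place ℚ) ∈ S} τ 3)
    (hT : D.transverse = cyclotomicTransverse (W.torsionGaloisModule ((3 : ℕ) : ℤ)))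
    (hD : D.HasCanonicalComparison 3 η)
    (κ : D.kolyvaginSystems (propagatedSelmerStructureOne W 3)) (hκ : κ.1 ∅ ≠ 0) :
    Nat.card (propagatedSelmerStructureOne W 3).selmerGroup = 3 := by
  have h1 := kolyvaginSystems_freeRankOne_propagatedSelmerStructureOne_of_surj W hS24 h3 τ hτμ hτq
    inv hperf hsum hunro hcompl hEP S hS h3S hbadS D η hP hT hD
  have hN : Nat.card (inv.dualSelmerStructure (W.torsionGaloisModule ((3 : ℕ) : ℤ))
      (D.atLevel (propagatedSelmerStructureOne W 3) ∅)).selmerGroup = 1 :=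
    dualSelmerGroup_natCard_eq_one_propagatedSelmerStructureOne_of_apply_ne_zero W hS24 hS24₂ h3 τ
      hτμ hτq inv hperf hsum hunro hcompl hEP S hS h3S hbadS D η hP hT hD inv hperf hsum
      hunro hcompl ∅ D.isLevel_empty κ hκ
  have hlam : LocalInvariants.lambdaStar inv (D.atLevel (propagatedSelmerStructureOne W 3) ∅) 3 = 0 := by
    unfold LocalInvariants.lambdaStar
    rw [hN, Nat.log_one_right]
  have hbij := h1.2 ∅ D.isLevel_empty hlam
  obtain ⟨e⟩ := h1.1
  have hKS : Nat.card (D.kolyvaginSystems (propagatedSelmerStructureOne W 3)) = 3 := by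
    rw [Nat.card_congr e.toEquiv, Nat.card_zmod]
  rw [← atLevel_empty D (propagatedSelmerStructureOne W 3), ← Nat.card_congr (Equiv.ofBijective _ hbij),
    hKS]

/-- **The level-one unit case for the `3`-Selmer group.**  If the bottom class `κ_∅` of some
Kolyvagin system `κ ∈ KS₁(E[3], 𝓕̄_can, 𝒫(τ))` is NOT a `3`-Selmer class (i.e. its singular part at
`3` is non-zero — the LEVEL-ONE CERTIFICATE; in practice Kato's Kolyvagin system with a `3`-adic
unit `L`-value under the explicit reciprocity law, NOT constructed here), then `Sel₃(E/ℚ) = 0`: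
`Sel₃ = H¹_𝓚 ≤ H¹_{𝓕̄_can}` (`𝓚 ≤ 𝓕̄_can`, n1011-p18), `#H¹_{𝓕̄_can} = 3` (previous theorem, as
`κ_∅ ∉ Sel₃ ⊇ {0}` gives `κ_∅ ≠ 0`), and `κ_∅ ∈ H¹_{𝓕̄_can} ∖ H¹_𝓚`, so `H¹_𝓚` is a proper subgroup
of a group of order `3`.  Conclusion in the tree's currency: `#Sel^{(3)}(E/ℚ) = 1`
(`WeierstrassCurve.selmerGroup`).  No tower; nothing booked. [cite: Sakamoto2024, Thm. 4.4 (p. 926)] -/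
theorem natCard_selmerGroup_three_eq_one_of_levelOne_certificate
    (hS24 : Sakamoto2024.kolyvaginSystems_freeRankOne_zmod_three_pow)
    (hS24₂ : Sakamoto2024.kolyvaginSystems_idealOfBasis_eq_fittingIdeal_zmod_three_pow)
    [Finite (geomTorsion W ((3 : ℕ) : ℤ))]
    (h3 : W.HasSurjectiveModNGaloisRep ((3 : ℕ) : ℤ))
    (τ : absoluteGaloisGroup ℚ) (hτμ : τ ∈ rootsOfUnityFixer ℚ 3)
    (hτq : Nonempty (cokerSubOne (W.torsionGaloisModule ((3 : ℕ) : ℤ)) τ ≃+ ZMod 3))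
    (inv : LocalInvariants ℚ 3) (hperf : inv.IsPerfect) (hsum : inv.SumLocalTermEqZero)
    (hunro : inv.UnramifiedOrthogonal) (hcompl : inv.SelmerComplement)
    (hEP : ∀ v : HeightOneSpectrum (𝓞 ℚ), localEulerPoincareCharacteristic (v.adicCompletion ℚ))
    (S : Finset (Place ℚ)) (hS : ∀ w : InfinitePlace ℚ, (Sum.inl w : Place ℚ) ∈ S)
    (h3S : ∀ v : HeightOneSpectrum (𝓞 ℚ), ((3 : ℕ) : 𝓞 ℚ) ∈ v.asIdeal → (Sum.inr v : Place ℚ) ∈ S)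
    (hbadS : ∀ v : HeightOneSpectrum (𝓞 ℚ), ¬ W.HasGoodReductionAt v → (Sum.inr v : Place ℚ) ∈ S)
    (D : KolyvaginDatum (W.torsionGaloisModule ((3 : ℕ) : ℤ)))
    (η : (q : HeightOneSpectrum (𝓞 ℚ)) → (ZMod (Ideal.absNorm q.asIdeal))ˣ)
    (hP : D.primes = frobeniusClassPrimes (W.torsionGaloisModule ((3 : ℕ) : ℤ))
      {v | (Sum.inr v : Place ℚ) ∈ S} τ 3)
    (hT : D.transverse = cyclotomicTransverse (W.torsionGaloisModule ((3 : ℕ) : ℤ)))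
    (hD : D.HasCanonicalComparison 3 η)
    (κ : D.kolyvaginSystems (propagatedSelmerStructureOne W 3))
    (hκ : κ.1 ∅ ∉ (W.kummerSelmerStructure ((3 : ℕ) : ℤ)).selmerGroup) :
    Nat.card (W.selmerGroup (3 : ℤ)) = 1 := by
  haveI : Fact (Nat.Prime 3) := ⟨Nat.prime_three⟩
  have hκ0 : κ.1 ∅ ≠ 0 := fun h => hκ (by rw [h]; exact zero_mem _)
  have hG3 : Nat.card (propagatedSelmerStructureOne W 3).selmerGroup = 3 :=
    natCard_selmerGroup_propagatedSelmerStructureOne_eq_three_of_apply_empty_ne_zero W hS24 hS24₂ h3 τ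
      hτμ hτq inv hperf hsum hunro hcompl hEP S hS h3S hbadS D η hP hT hD κ hκ0
  have hle : (W.kummerSelmerStructure ((3 : ℕ) : ℤ)).selmerGroup ≤
      (propagatedSelmerStructureOne W 3).selmerGroup := fun x hx =>
    (SelmerStructure.mem_selmerGroup_iff _ x).2 fun v =>
      KummerCondition.kummerSelmerStructure_le_propagatedSelmerStructureOne W 3 v
        ((SelmerStructure.mem_selmerGroup_iff _ x).1 hx v)
  have hmem : κ.1 ∅ ∈ (propagatedSelmerStructureOne W 3).selmerGroup :=
    ((KolyvaginDatum.mem_kolyvaginSystems_iff D _ κ.1).mp κ.2).apply_empty_mem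
  haveI : Finite (propagatedSelmerStructureOne W 3).selmerGroup :=
    Nat.finite_of_card_ne_zero (by rw [hG3]; norm_num)
  have hdvd : Nat.card (W.kummerSelmerStructure ((3 : ℕ) : ℤ)).selmerGroup ∣
      Nat.card (propagatedSelmerStructureOne W 3).selmerGroup := AddSubgroup.card_dvd_of_le hle
  rw [hG3] at hdvd
  rcases (Nat.dvd_prime Nat.prime_three).mp hdvd with h1 | h3'
  · rw [selmerGroup_eq_selmerGroup_kummerSelmerStructure]
    exact h1
  · exfalso
    have heq : (W.kummerSelmerStructure ((3 : ℕ) : ℤ)).selmerGroup =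
        (propagatedSelmerStructureOne W 3).selmerGroup :=
      AddSubgroup.eq_of_le_of_card_ge hle (by rw [hG3, h3'])
    exact hκ (by rw [heq]; exact hmem)

/-- **BSD(E, 3) from a level-one Kolyvagin certificate — the EXOTIC unit case, class-free.**  For
`E/ℚ` with `ρ̄_{E,3}` onto, analytic rank `0` and `3 ∤ #Ш(E)_an`: given the two [S24] named facts
(Thm. 4.4 (1), (2) for `R = 𝔽₃`), Gross–Zagier–Kolyvagin (`hGZK`, named fact), the Poitou–Tate
family, Tate's local Euler–Poincaré characteristic `hEP` ((Lp) is discharged from it: p04 T-Lp),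
an admissible `S`, a Kolyvagin datum on `E[3]` for Sakamoto's primes `𝒫(τ)` with the
cyclotomic transverse conditions and the canonical comparison maps, and a LEVEL-ONE CERTIFICATE —
a Kolyvagin system `κ ∈ KS₁(E[3], 𝓕̄_can, 𝒫(τ))` whose bottom class is not a `3`-Selmer class —
`BSD(E, 3)` holds (previous theorem + n1011-p13's `3`-Selmer certificate consumer
`Additive.X4RankZero.bsdp_three_of_card_selmerThree_eq_one`, Miller / Silverman X.4.2).  NO `3`-adic
tower, NO image-(im), NO reduction-type hypothesis: this is the shape that reaches the EXOTIC rows of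
§I N11 (surj(3) ∧ ¬surj(9)), where (im)/the tower fail.  What is NOT proved here (binders, nothing
hidden): the two [S24] facts, `hGZK`, the PT family, `hEP`, and above all the CERTIFICATE
(Kato's Kolyvagin system at level one with a `3`-unit bottom class: explicit reciprocity / DICT3 at an
additive prime, route R1-21/R1-24).  Referee-1 ACK-1 proviso (skel/T-a5x-L1 §3, verbatim):
"(CERT) `κ : D.kolyvaginSystems (propagatedSelmerStructureOne W 3)`,
`hκ : κ.1 ∅ ∉ (W.kummerSelmerStructure 3).selmerGroup` — the level-one certificate: a Kolyvagin
system for (E[3], 𝓕̄_can, 𝒫(τ)) whose bottom class is NOT a 3-Selmer class (⟺ its singular part at 3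
is non-zero). In print this is Kato's Kolyvagin system (MR04 Thm 3.2.4 / [K22]) at level one + the
explicit reciprocity law at the ADDITIVE prime 3 (DICT3, route R1-21 + R1-24) + L(E,1)/Ω a 3-adic
unit + E(ℚ₃)[3] = 0 — NONE of which is in the tree for additive p = 3: the located gap of the row,
typed by this binder."  **EXOTIC rows are reduced to (F1)(F2)(F3)(PT)(EP)(Lp) + the certificate;
none is closed** — and (Lp) is by now a theorem from (EP) (n1011-p04's T-Lp,
`natCard_propagatedSelmerStructureOne_three`), consumed here, so no (Lp) binder appears.  Nothing booked; no mark / label changed.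
[cite: Sakamoto2024, Thm. 4.4 (p. 926)] [cite: Miller2011LMS, §1 and Def. 1.1]
[cite: SilvermanAEC2009, Thm X.4.2(a)] -/
theorem bsdp_three_of_levelOne_certificate
    (hS24 : Sakamoto2024.kolyvaginSystems_freeRankOne_zmod_three_pow)
    (hS24₂ : Sakamoto2024.kolyvaginSystems_idealOfBasis_eq_fittingIdeal_zmod_three_pow)
    (hGZK : rank_eq_analyticRank_of_analyticRank_le_one)
    [Finite (geomTorsion W ((3 : ℕ) : ℤ))]
    (h3 : W.HasSurjectiveModNGaloisRep ((3 : ℕ) : ℤ)) (hr : W.analyticRank = 0)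
    {q : ℚ} (hq : shaAn W = (q : ℂ)) (hv : padicValRat 3 q = 0)
    (τ : absoluteGaloisGroup ℚ) (hτμ : τ ∈ rootsOfUnityFixer ℚ 3)
    (hτq : Nonempty (cokerSubOne (W.torsionGaloisModule ((3 : ℕ) : ℤ)) τ ≃+ ZMod 3))
    (inv : LocalInvariants ℚ 3) (hperf : inv.IsPerfect) (hsum : inv.SumLocalTermEqZero)
    (hunro : inv.UnramifiedOrthogonal) (hcompl : inv.SelmerComplement)
    (hEP : ∀ v : HeightOneSpectrum (𝓞 ℚ), localEulerPoincareCharacteristic (v.adicCompletion ℚ))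
    (S : Finset (Place ℚ)) (hS : ∀ w : InfinitePlace ℚ, (Sum.inl w : Place ℚ) ∈ S)
    (h3S : ∀ v : HeightOneSpectrum (𝓞 ℚ), ((3 : ℕ) : 𝓞 ℚ) ∈ v.asIdeal → (Sum.inr v : Place ℚ) ∈ S)
    (hbadS : ∀ v : HeightOneSpectrum (𝓞 ℚ), ¬ W.HasGoodReductionAt v → (Sum.inr v : Place ℚ) ∈ S)
    (D : KolyvaginDatum (W.torsionGaloisModule ((3 : ℕ) : ℤ)))
    (η : (q : HeightOneSpectrum (𝓞 ℚ)) → (ZMod (Ideal.absNorm q.asIdeal))ˣ)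
    (hP : D.primes = frobeniusClassPrimes (W.torsionGaloisModule ((3 : ℕ) : ℤ))
      {v | (Sum.inr v : Place ℚ) ∈ S} τ 3)
    (hT : D.transverse = cyclotomicTransverse (W.torsionGaloisModule ((3 : ℕ) : ℤ)))
    (hD : D.HasCanonicalComparison 3 η)
    (κ : D.kolyvaginSystems (propagatedSelmerStructureOne W 3))
    (hκ : κ.1 ∅ ∉ (W.kummerSelmerStructure ((3 : ℕ) : ℤ)).selmerGroup) :
    BSDp W 3 :=
  Additive.X4RankZero.bsdp_three_of_card_selmerThree_eq_one W hGZK hr hq hv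
    (natCard_selmerGroup_three_eq_one_of_levelOne_certificate W hS24 hS24₂ h3 τ hτμ hτq inv hperf hsum
      hunro hcompl hEP S hS h3S hbadS D η hP hT hD κ hκ)


/-- **The EXOTIC rows of §I N11, displayed.**  `bsdp_three_of_levelOne_certificate` read on ClassX4 at
`3`, analytic rank `0`, surj(3), `3`-adic tower FAILING (Elkies' `9`-deficient image —
`residualHypotheses_and_not_bigIm_of_exotic`): the level-one certificate closes `BSD(E,3)` there.  The
class binders are DOCUMENTATION ONLY (underscore-named); the proof is the class-free one.  EXOTIC
rows are reduced to (F1)(F2)(F3)(PT)(EP)(Lp) + the certificate; none is closed.  Not a class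
theorem; nothing booked. [cite: Sakamoto2024, Thm. 4.4 (p. 926)] [cite: Miller2011LMS, §1 and Def. 1.1] -/
theorem bsdp_three_exotic_of_levelOne_certificate
    (hS24 : Sakamoto2024.kolyvaginSystems_freeRankOne_zmod_three_pow)
    (hS24₂ : Sakamoto2024.kolyvaginSystems_idealOfBasis_eq_fittingIdeal_zmod_three_pow)
    (hGZK : rank_eq_analyticRank_of_analyticRank_le_one)
    [Finite (geomTorsion W ((3 : ℕ) : ℤ))]
    (_hX : Literature.NumberTheory.EllipticCurves.Rank1Residual.ClassX4 W 3) (_hexotic : ¬ ∀ n : ℕ, W.HasSurjectiveModNGaloisRep (3 ^ n : ℕ))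
    (h3 : W.HasSurjectiveModNGaloisRep ((3 : ℕ) : ℤ)) (hr : W.analyticRank = 0)
    {q : ℚ} (hq : shaAn W = (q : ℂ)) (hv : padicValRat 3 q = 0)
    (τ : absoluteGaloisGroup ℚ) (hτμ : τ ∈ rootsOfUnityFixer ℚ 3)
    (hτq : Nonempty (cokerSubOne (W.torsionGaloisModule ((3 : ℕ) : ℤ)) τ ≃+ ZMod 3))
    (inv : LocalInvariants ℚ 3) (hperf : inv.IsPerfect) (hsum : inv.SumLocalTermEqZero)
    (hunro : inv.UnramifiedOrthogonal) (hcompl : inv.SelmerComplement)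
    (hEP : ∀ v : HeightOneSpectrum (𝓞 ℚ), localEulerPoincareCharacteristic (v.adicCompletion ℚ))
    (S : Finset (Place ℚ)) (hS : ∀ w : InfinitePlace ℚ, (Sum.inl w : Place ℚ) ∈ S)
    (h3S : ∀ v : HeightOneSpectrum (𝓞 ℚ), ((3 : ℕ) : 𝓞 ℚ) ∈ v.asIdeal → (Sum.inr v : Place ℚ) ∈ S)
    (hbadS : ∀ v : HeightOneSpectrum (𝓞 ℚ), ¬ W.HasGoodReductionAt v → (Sum.inr v : Place ℚ) ∈ S)
    (D : KolyvaginDatum (W.torsionGaloisModule ((3 : ℕ) : ℤ)))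
    (η : (q : HeightOneSpectrum (𝓞 ℚ)) → (ZMod (Ideal.absNorm q.asIdeal))ˣ)
    (hP : D.primes = frobeniusClassPrimes (W.torsionGaloisModule ((3 : ℕ) : ℤ))
      {v | (Sum.inr v : Place ℚ) ∈ S} τ 3)
    (hT : D.transverse = cyclotomicTransverse (W.torsionGaloisModule ((3 : ℕ) : ℤ)))
    (hD : D.HasCanonicalComparison 3 η)
    (κ : D.kolyvaginSystems (propagatedSelmerStructureOne W 3))
    (hκ : κ.1 ∅ ∉ (W.kummerSelmerStructure ((3 : ℕ) : ℤ)).selmerGroup) :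
    BSDp W 3 :=
  bsdp_three_of_levelOne_certificate W hS24 hS24₂ hGZK h3 hr hq hv τ hτμ hτq inv hperf hsum hunro hcompl
    hEP S hS h3S hbadS D η hP hT hD κ hκ


/-- **Everything constructible discharged: `τ`, `η` and the Kolyvagin datum EXIST** (p252385 /
p260356 for `τ`; n1011-p04's T-HCC `FSComp.exists_eta_kolyvaginDatum_hasCanonicalComparison_frobeniusClassPrimes`
for `η`, `D` — unconditional over `ℚ`), so the EXOTIC unit case reads: from surj(3), `r_an = 0`,
`3 ∤ #Ш_an`, the three named facts, the Poitou–Tate family, `hEP` and an admissible `S`, THERE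
ARE `τ ∈ Γ_{ℚ(μ₃)}` (`E[3]/(τ−1) ≃ 𝔽₃`), primitive roots `η` and a Kolyvagin datum `D` on `E[3]` for
Sakamoto's primes `𝒫(τ)` (cyclotomic transverse conditions, THE canonical comparison maps) such that
ANY Kolyvagin system `κ ∈ KS₁(E[3], 𝓕̄_can, 𝒫(τ))` whose bottom class is not a `3`-Selmer class
certifies `BSD(E, 3)`.  The certificate itself is NOT constructed; EXOTIC rows are reduced to
(F1)(F2)(F3)(PT)(EP)(Lp) + the certificate; none is closed.  Nothing booked.
[cite: Sakamoto2024, §2 (H.2), §4 and Thm. 4.4 (pp. 921–926)] [cite: Rubin2011, Def. 1.9.6 and Def. 2.1.3 (pp. 14, 17)] -/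
theorem exists_kolyvaginDatum_bsdp_three_of_levelOne_certificate
    (hS24 : Sakamoto2024.kolyvaginSystems_freeRankOne_zmod_three_pow)
    (hS24₂ : Sakamoto2024.kolyvaginSystems_idealOfBasis_eq_fittingIdeal_zmod_three_pow)
    (hGZK : rank_eq_analyticRank_of_analyticRank_le_one)
    [Finite (geomTorsion W ((3 : ℕ) : ℤ))]
    (h3 : W.HasSurjectiveModNGaloisRep ((3 : ℕ) : ℤ)) (hr : W.analyticRank = 0)
    {q : ℚ} (hq : shaAn W = (q : ℂ)) (hv : padicValRat 3 q = 0)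
    (inv : LocalInvariants ℚ 3) (hperf : inv.IsPerfect) (hsum : inv.SumLocalTermEqZero)
    (hunro : inv.UnramifiedOrthogonal) (hcompl : inv.SelmerComplement)
    (hEP : ∀ v : HeightOneSpectrum (𝓞 ℚ), localEulerPoincareCharacteristic (v.adicCompletion ℚ))
    (S : Finset (Place ℚ)) (hS : ∀ w : InfinitePlace ℚ, (Sum.inl w : Place ℚ) ∈ S)
    (h3S : ∀ v : HeightOneSpectrum (𝓞 ℚ), ((3 : ℕ) : 𝓞 ℚ) ∈ v.asIdeal → (Sum.inr v : Place ℚ) ∈ S)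
    (hbadS : ∀ v : HeightOneSpectrum (𝓞 ℚ), ¬ W.HasGoodReductionAt v → (Sum.inr v : Place ℚ) ∈ S) :
    ∃ (τ : absoluteGaloisGroup ℚ) (η : (q : HeightOneSpectrum (𝓞 ℚ)) → (ZMod (Ideal.absNorm q.asIdeal))ˣ)
      (D : KolyvaginDatum (W.torsionGaloisModule ((3 : ℕ) : ℤ))),
      τ ∈ rootsOfUnityFixer ℚ 3 ∧
      Nonempty (cokerSubOne (W.torsionGaloisModule ((3 : ℕ) : ℤ)) τ ≃+ ZMod 3) ∧
      D.primes = frobeniusClassPrimes (W.torsionGaloisModule ((3 : ℕ) : ℤ))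
        {v | (Sum.inr v : Place ℚ) ∈ S} τ 3 ∧
      D.transverse = cyclotomicTransverse (W.torsionGaloisModule ((3 : ℕ) : ℤ)) ∧
      D.HasCanonicalComparison 3 η ∧
      ∀ κ : D.kolyvaginSystems (propagatedSelmerStructureOne W 3),
        κ.1 ∅ ∉ (W.kummerSelmerStructure ((3 : ℕ) : ℤ)).selmerGroup → BSDp W 3 := by
  obtain ⟨τ, hτ, hτq⟩ := exists_rootsOfUnityFixer_cokerSubOne_equiv_zmod_three_of_surj W h3
  have hτμ : τ ∈ rootsOfUnityFixer ℚ 3 := hτ 3 (by norm_num)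
  obtain ⟨η, D, hP, hT, hD⟩ :=
    FSComp.exists_eta_kolyvaginDatum_hasCanonicalComparison_frobeniusClassPrimes
      (W.torsionGaloisModule ((3 : ℕ) : ℤ)) 3 {v | (Sum.inr v : Place ℚ) ∈ S} hτμ hτq
      (cyclotomicTransverse (W.torsionGaloisModule ((3 : ℕ) : ℤ)))
  exact ⟨τ, η, D, hτμ, hτq, hP, hT, hD, fun κ hκ =>
    bsdp_three_of_levelOne_certificate W hS24 hS24₂ hGZK h3 hr hq hv τ hτμ hτq inv hperf hsum hunro
      hcompl hEP S hS h3S hbadS D η hP hT hD κ hκ⟩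

end Summit.BirchSwinnertonDyer.Rank1Residual.GaloisImage

end
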